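import Summits.Ventures.PackingBounds.Configurations.ListConfigKeys
import Mathlib.NumberTheory.Zsqrtd.ToReal

/-!
# `A(12, arccos 1/3) ≥ 168`: the `(12, 144, 4)` binary code from the Steiner system `S(5, 6, 12)` plus the `24` axis vectors

Framing: lottery ticket; floor = certified bounds/negative ranges. Venture `PackingBounds` (cell `pub-packcert`, seat
`pub-packcert-sdp`), ATTAINED side of the B2c cell `(12, 1/3)` (certified three-point value `247`; attained entry so far
`160`, `Config.ConsA.exists_code_third_160`, Construction A on a triple packing).

The construction. The `132` hexads of the Steiner system `S(5, 6, 12)` — here: the intersections of size `6` of the octads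
of the tree's extended Golay code (`Config.Leech.cw`, `Configurations/LeechGolay.lean`) with its dodecad supported on the
coordinates `1, …, 12` — pairwise meet in `0, 2, 3, 4` points, so as binary words of length `12` they are at Hamming distance
`12, 8, 6, 4`; together with the six words of weight `2` of a perfect matching and their complements they form a binary
code of length `12`, size `132 + 6 + 6 = 144` and minimum distance `4` (distances `4, 6, 8, 12`; `144 = A₂(12, 4)`).  Written
as sign vectors `(±1)¹²` (squared length `12`) the `144` words have pairwise inner products `12 - 2d ∈ {4, 0, -4, -12}`, i.e.
cosines `≤ 1/3`; the `24` vectors `± 2√3 e_i` (squared length `12`) have inner products `± 2√3` with them (cosine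
`1/√12 < 1/3`) and `0, -12` among themselves.  Hence **`A(12, arccos 1/3) ≥ 168`**.  The `168` rows are entered over
`ℤ[√3]` (`Zsqrtd 3`, real embedding `Zsqrtd.toReal`); the kernel checks lengths/norms (`shapeOK`) and that every inner
product of two distinct rows is one of the six keys (`keysRowsOK`, `Configurations/ListConfigKeys.lean`); the real-side
step is `2√3 ≤ 4`.  Generator and checks (S(5,6,12) property, distance distribution `4: 3360, 6: 3504, 8: 3360, 12: 72`):
seat script `work/hex12/build.py` (pub-packcert-sdp gen 17).  No optimality claim.

## References
* J. H. Conway, N. J. A. Sloane, *Sphere Packings, Lattices and Groups*, 3rd ed., Ch. 3 §2.4 (Golay codes), Ch. 11 §2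
  (the Steiner systems `S(5, 8, 24)` and `S(5, 6, 12)`), Ch. 5 §1 (codes as spherical codes). [`ConwaySloane1999`]
-/

namespace Summit.Ventures.PackingBounds.Config.CodeThird12Hexads

open Finset Summit.Ventures.PackingBounds.Config

/-- `0 ≤ 3`. -/
private theorem hD : (0 : ℤ) ≤ 3 := by norm_num

/-- `3` is not a square. -/
private theorem d_not_square : ∀ k : ℤ, (3 : ℤ) ≠ k * k := by
  intro k h
  have h1 : k.natAbs * k.natAbs = 3 := by
    have := Int.natAbs_mul_self' k; omega
  have h2 : k.natAbs ≤ 3 := by nlinarith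
  interval_cases k.natAbs <;> omega

/-- Entry `+1`. -/
def p : Zsqrtd 3 := ⟨1, 0⟩
/-- Entry `-1`. -/
def m : Zsqrtd 3 := ⟨-1, 0⟩
/-- Entry `0`. -/
def z : Zsqrtd 3 := ⟨0, 0⟩
/-- Entry `2√3`. -/
def r : Zsqrtd 3 := ⟨0, 2⟩
/-- Entry `-2√3`. -/
def s : Zsqrtd 3 := ⟨0, -2⟩

/-- The `132` hexads of `S(5, 6, 12)` as `12`-bit masks (bit `k` = point `k`; from the Golay octads meeting the dodecad on
coordinates `1..12` in six points), followed by the perfect matching `{0,1}, …, {10,11}` and its complements: the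
`(12, 144, 4)` code.  Recorded for reference; the rows below are its sign vectors. -/
def codeWords : List ℕ := [125, 183, 207, 250, 315, 343, 366, 414, 429, 473, 483, 500, 543, 619, 630, 686, 697, 723, 732, 741, 807, 828, 845, 858, 881, 907, 917, 946, 966, 1000, 1086, 1115, 1127, 1181, 1195, 1238, 1260, 1265, 1295, 1333, 1372, 1385, 1394, 1427, 1446, 1464, 1477, 1482, 1581, 1587, 1614, 1621, 1656, 1671, 1690, 1716, 1737, 1762, 1814, 1817, 1834, 1859, 1892, 1932, 1953, 2000, 2095, 2142, 2163, 2203, 2236, 2261, 2278, 2281, 2333, 2358, 2379, 2405, 2424, 2439, 2474, 2481, 2508, 2514, 2613, 2618, 2631, 2649, 2668, 2701, 2710, 2723, 2762, 2800, 2830, 2835, 2857, 2900, 2914, 2968, 2980, 3009, 3095, 3129, 3149, 3178, 3188, 3214, 3237, 3250, 3267, 3288, 3354, 3363, 3372, 3398, 3409, 3465, 3476, 3552, 3595, 3612, 3622, 3666, 3681, 3729, 3752, 3780, 3845, 3888, 3912, 3970, 3, 12, 48, 192, 768, 3072, 4092, 4083, 4047, 3903, 3327, 1023]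

/-- The `168` rows: `144` sign vectors of the code words (`p = +1` for bit `0`, `m = -1` for bit `1`) and the `24` axis
vectors `± 2√3 e_i`; common squared length `12`. -/
def rows : List (List (Zsqrtd 3)) := [
  [m, p, m, m, m, m, m, p, p, p, p, p],
  [m, m, m, p, m, m, p, m, p, p, p, p],
  [m, m, m, m, p, p, m, m, p, p, p, p],
  [p, m, p, m, m, m, m, m, p, p, p, p],
  [m, m, p, m, m, m, p, p, m, p, p, p],
  [m, m, m, p, m, p, m, p, m, p, p, p],
  [p, m, m, m, p, m, m, p, m, p, p, p],
  [p, m, m, m, m, p, p, m, m, p, p, p],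
  [m, p, m, m, p, m, p, m, m, p, p, p],
  [m, p, p, m, m, p, m, m, m, p, p, p],
  [m, m, p, p, p, m, m, m, m, p, p, p],
  [p, p, m, p, m, m, m, m, m, p, p, p],
  [m, m, m, m, m, p, p, p, p, m, p, p],
  [m, m, p, m, p, m, m, p, p, m, p, p],
  [p, m, m, p, m, m, m, p, p, m, p, p],
  [p, m, m, m, p, m, p, m, p, m, p, p],
  [m, p, p, m, m, m, p, m, p, m, p, p],
  [m, m, p, p, m, p, m, m, p, m, p, p],
  [p, p, m, m, m, p, m, m, p, m, p, p],
  [m, p, m, p, p, m, m, m, p, m, p, p],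
  [m, m, m, p, p, m, p, p, m, m, p, p],
  [p, p, m, m, m, m, p, p, m, m, p, p],
  [m, p, m, m, p, p, m, p, m, m, p, p],
  [p, m, p, m, m, p, m, p, m, m, p, p],
  [m, p, p, p, m, m, m, p, m, m, p, p],
  [m, m, p, m, p, p, p, m, m, m, p, p],
  [m, p, m, p, m, p, p, m, m, m, p, p],
  [p, m, p, p, m, m, p, m, m, m, p, p],
  [p, m, m, p, p, p, m, m, m, m, p, p],
  [p, p, p, m, p, m, m, m, m, m, p, p],
  [p, m, m, m, m, m, p, p, p, p, m, p],
  [m, m, p, m, m, p, m, p, p, p, m, p],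
  [m, m, m, p, p, m, m, p, p, p, m, p],
  [m, p, m, m, m, p, p, m, p, p, m, p],
  [m, m, p, m, p, m, p, m, p, p, m, p],
  [p, m, m, p, m, p, m, m, p, p, m, p],
  [p, p, m, m, p, m, m, m, p, p, m, p],
  [m, p, p, p, m, m, m, m, p, p, m, p],
  [m, m, m, m, p, p, p, p, m, p, m, p],
  [m, p, m, p, m, m, p, p, m, p, m, p],
  [p, p, m, m, m, p, m, p, m, p, m, p],
  [m, p, p, m, p, m, m, p, m, p, m, p],
  [p, m, p, p, m, m, m, p, m, p, m, p],
  [m, m, p, p, m, p, p, m, m, p, m, p],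
  [p, m, m, p, p, m, p, m, m, p, m, p],
  [p, p, p, m, m, m, p, m, m, p, m, p],
  [m, p, m, p, p, p, m, m, m, p, m, p],
  [p, m, p, m, p, p, m, m, m, p, m, p],
  [m, p, m, m, p, m, p, p, p, m, m, p],
  [m, m, p, p, m, m, p, p, p, m, m, p],
  [p, m, m, m, p, p, m, p, p, m, m, p],
  [m, p, m, p, m, p, m, p, p, m, m, p],
  [p, p, p, m, m, m, m, p, p, m, m, p],
  [m, m, m, p, p, p, p, m, p, m, m, p],
  [p, m, p, m, m, p, p, m, p, m, m, p],
  [p, p, m, p, m, m, p, m, p, m, m, p],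
  [m, p, p, m, p, p, m, m, p, m, m, p],
  [p, m, p, p, p, m, m, m, p, m, m, p],
  [p, m, m, p, m, p, p, p, m, m, m, p],
  [m, p, p, m, m, p, p, p, m, m, m, p],
  [p, m, p, m, p, m, p, p, m, m, m, p],
  [m, m, p, p, p, p, m, p, m, m, m, p],
  [p, p, m, p, p, m, m, p, m, m, m, p],
  [p, p, m, m, p, p, p, m, m, m, m, p],
  [m, p, p, p, p, m, p, m, m, m, m, p],
  [p, p, p, p, m, p, m, m, m, m, m, p],
  [m, m, m, m, p, m, p, p, p, p, p, m],
  [p, m, m, m, m, p, m, p, p, p, p, m],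
  [m, m, p, p, m, m, m, p, p, p, p, m],
  [m, m, p, m, m, p, p, m, p, p, p, m],
  [p, p, m, m, m, m, p, m, p, p, p, m],
  [m, p, m, p, m, p, m, m, p, p, p, m],
  [p, m, m, p, p, m, m, m, p, p, p, m],
  [m, p, p, m, p, m, m, m, p, p, p, m],
  [m, p, m, m, m, p, p, p, m, p, p, m],
  [p, m, m, p, m, m, p, p, m, p, p, m],
  [m, m, p, m, p, p, m, p, m, p, p, m],
  [m, p, m, p, p, m, m, p, m, p, p, m],
  [p, p, p, m, m, m, m, p, m, p, p, m],
  [m, m, m, p, p, p, p, m, m, p, p, m],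
  [p, m, p, m, p, m, p, m, m, p, p, m],
  [m, p, p, p, m, m, p, m, m, p, p, m],
  [p, p, m, m, p, p, m, m, m, p, p, m],
  [p, m, p, p, m, p, m, m, m, p, p, m],
  [m, p, m, p, m, m, p, p, p, m, p, m],
  [p, m, p, m, m, m, p, p, p, m, p, m],
  [m, m, m, p, p, p, m, p, p, m, p, m],
  [m, p, p, m, m, p, m, p, p, m, p, m],
  [p, p, m, m, p, m, m, p, p, m, p, m],
  [m, p, m, m, p, p, p, m, p, m, p, m],
  [p, m, m, p, m, p, p, m, p, m, p, m],
  [m, m, p, p, p, m, p, m, p, m, p, m],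
  [p, m, p, m, p, p, m, m, p, m, p, m],
  [p, p, p, p, m, m, m, m, p, m, p, m],
  [p, m, m, m, p, p, p, p, m, m, p, m],
  [m, m, p, p, m, p, p, p, m, m, p, m],
  [m, p, p, m, p, m, p, p, m, m, p, m],
  [p, p, m, p, m, p, m, p, m, m, p, m],
  [p, m, p, p, p, m, m, p, m, m, p, m],
  [p, p, p, m, m, p, p, m, m, m, p, m],
  [p, p, m, p, p, m, p, m, m, m, p, m],
  [m, p, p, p, p, p, m, m, m, m, p, m],
  [m, m, m, p, m, p, p, p, p, p, m, m],
  [m, p, p, m, m, m, p, p, p, p, m, m],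
  [m, p, m, m, p, p, m, p, p, p, m, m],
  [p, m, p, m, p, m, m, p, p, p, m, m],
  [p, p, m, p, m, m, m, p, p, p, m, m],
  [p, m, m, m, p, p, p, m, p, p, m, m],
  [m, p, m, p, p, m, p, m, p, p, m, m],
  [p, m, p, p, m, m, p, m, p, p, m, m],
  [m, m, p, p, p, p, m, m, p, p, m, m],
  [p, p, p, m, m, p, m, m, p, p, m, m],
  [p, m, p, m, m, p, p, p, m, p, m, m],
  [m, m, p, p, p, m, p, p, m, p, m, m],
  [p, p, m, m, p, m, p, p, m, p, m, m],
  [p, m, m, p, p, p, m, p, m, p, m, m],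
  [m, p, p, p, m, p, m, p, m, p, m, m],
  [m, p, p, m, p, p, p, m, m, p, m, m],
  [p, p, m, p, m, p, p, m, m, p, m, m],
  [p, p, p, p, p, m, m, m, m, p, m, m],
  [m, m, p, m, p, p, p, p, p, m, m, m],
  [p, p, m, m, m, p, p, p, p, m, m, m],
  [p, m, m, p, p, m, p, p, p, m, m, m],
  [p, m, p, p, m, p, m, p, p, m, m, m],
  [m, p, p, p, p, m, m, p, p, m, m, m],
  [m, p, p, p, m, p, p, m, p, m, m, m],
  [p, p, p, m, p, m, p, m, p, m, m, m],
  [p, p, m, p, p, p, m, m, p, m, m, m],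
  [m, p, m, p, p, p, p, p, m, m, m, m],
  [p, p, p, p, m, m, p, p, m, m, m, m],
  [p, p, p, m, p, p, m, p, m, m, m, m],
  [p, m, p, p, p, p, p, m, m, m, m, m],
  [m, m, p, p, p, p, p, p, p, p, p, p],
  [p, p, m, m, p, p, p, p, p, p, p, p],
  [p, p, p, p, m, m, p, p, p, p, p, p],
  [p, p, p, p, p, p, m, m, p, p, p, p],
  [p, p, p, p, p, p, p, p, m, m, p, p],
  [p, p, p, p, p, p, p, p, p, p, m, m],
  [p, p, m, m, m, m, m, m, m, m, m, m],
  [m, m, p, p, m, m, m, m, m, m, m, m],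
  [m, m, m, m, p, p, m, m, m, m, m, m],
  [m, m, m, m, m, m, p, p, m, m, m, m],
  [m, m, m, m, m, m, m, m, p, p, m, m],
  [m, m, m, m, m, m, m, m, m, m, p, p],
  [r, z, z, z, z, z, z, z, z, z, z, z],
  [s, z, z, z, z, z, z, z, z, z, z, z],
  [z, r, z, z, z, z, z, z, z, z, z, z],
  [z, s, z, z, z, z, z, z, z, z, z, z],
  [z, z, r, z, z, z, z, z, z, z, z, z],
  [z, z, s, z, z, z, z, z, z, z, z, z],
  [z, z, z, r, z, z, z, z, z, z, z, z],
  [z, z, z, s, z, z, z, z, z, z, z, z],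
  [z, z, z, z, r, z, z, z, z, z, z, z],
  [z, z, z, z, s, z, z, z, z, z, z, z],
  [z, z, z, z, z, r, z, z, z, z, z, z],
  [z, z, z, z, z, s, z, z, z, z, z, z],
  [z, z, z, z, z, z, r, z, z, z, z, z],
  [z, z, z, z, z, z, s, z, z, z, z, z],
  [z, z, z, z, z, z, z, r, z, z, z, z],
  [z, z, z, z, z, z, z, s, z, z, z, z],
  [z, z, z, z, z, z, z, z, r, z, z, z],
  [z, z, z, z, z, z, z, z, s, z, z, z],
  [z, z, z, z, z, z, z, z, z, r, z, z],
  [z, z, z, z, z, z, z, z, z, s, z, z],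
  [z, z, z, z, z, z, z, z, z, z, r, z],
  [z, z, z, z, z, z, z, z, z, z, s, z],
  [z, z, z, z, z, z, z, z, z, z, z, r],
  [z, z, z, z, z, z, z, z, z, z, z, s]]

/-- The admissible inner products of distinct rows: `4, 0, -4, -12` (code/code, axis/axis) and `± 2√3` (code/axis). -/
def keys : List (Zsqrtd 3) := [⟨4, 0⟩, ⟨0, 0⟩, ⟨-4, 0⟩, ⟨-12, 0⟩, ⟨0, 2⟩, ⟨0, -2⟩]

/-- Kernel check: `144` code words. -/
theorem length_codeWords : codeWords.length = 144 := by decide +kernel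

/-- Kernel check: `168` rows. -/
theorem length_rows : rows.length = 168 := by decide +kernel

set_option maxRecDepth 100000 in
/-- Kernel check: every row has length `12` and squared length `12`. -/
theorem shape_rows : shapeOK rows 12 (⟨12, 0⟩ : Zsqrtd 3) = true := by decide +kernel

set_option maxRecDepth 100000 in
set_option maxHeartbeats 4000000 in
/-- Kernel check: every inner product of two distinct rows is one of the `keys`. -/
theorem keys_rows : keysRowsOK rows keys rows = true := by decide +kernel

/-- `12` is not a key. -/
private theorem q_not_key : (⟨12, 0⟩ : Zsqrtd 3) ∉ keys := by decide

/-- `ι 12 > 0`. -/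
private theorem hq : 0 < (Zsqrtd.toReal hD) (⟨12, 0⟩ : Zsqrtd 3) := by
  rw [Zsqrtd.toReal_apply]; push_cast; norm_num

/-- Every key, normalised by `12`, is `≤ 1/3` (for `2√3` this is `√3 ≤ 2`). -/
private theorem keys_le : ∀ k ∈ keys,
    (Zsqrtd.toReal hD) k / (Zsqrtd.toReal hD) (⟨12, 0⟩ : Zsqrtd 3) ≤ 1 / 3 := by
  have hs : Real.sqrt 3 * Real.sqrt 3 = 3 := Real.mul_self_sqrt (by norm_num)
  have hs0 : 0 ≤ Real.sqrt 3 := Real.sqrt_nonneg 3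
  intro k hk
  simp only [keys, List.mem_cons, List.not_mem_nil, or_false] at hk
  rw [div_le_div_iff₀ hq (by norm_num)]
  rcases hk with rfl | rfl | rfl | rfl | rfl | rfl <;>
    (rw [Zsqrtd.toReal_apply, Zsqrtd.toReal_apply]; push_cast; nlinarith)

/-- **`A(12, arccos 1/3) ≥ 168`**: `168` unit vectors of `ℝ¹²` with pairwise inner products `≤ 1/3` (the `(12, 144, 4)` code
from the hexads of `S(5, 6, 12)` as sign vectors, and the `24` vectors `± e_i`). [cite: ConwaySloane1999, Ch. 11 §2] -/
theorem exists_code_third_168 : ∃ C : Finset (EuclideanSpace ℝ (Fin 12)), C.card = 168 ∧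
    (∀ x ∈ C, ‖x‖ = 1) ∧ ∀ x ∈ C, ∀ y ∈ C, x ≠ y → inner ℝ x y ≤ 1 / 3 := by
  obtain ⟨C, hc, h1, h2⟩ := exists_code_keys (Zsqrtd.toReal_injective hD d_not_square) hq shape_rows keys_rows
    q_not_key _ keys_le
  exact ⟨C, hc.trans length_rows, h1, h2⟩

end Summit.Ventures.PackingBounds.Config.CodeThird12Hexads
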